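import Mathlib
import HarnessLib
import Summits.QuantumFields.YangMills.Theorems.LangevinControlUVFemtoCurvatureTwoPointAxisProfileAntitone
import Summits.QuantumFields.YangMills.Theorems.LangevinControlUVFemtoCurvatureTwoPointPlaqReflectCauchySchwarz

/-!
# Crux `FemtoCurvatureTwoPoint` (stmt-QuantumFields-9363, route `LangevinControlUV`):
# off-axis domination, part A — engines (RP helper part 6)

Helper for the line `generic-step-gamma-encoding` (lead prover, `--supports stmt-QuantumFields-9363`):
the β-uniform machinery behind the line's stub OA (`stub_offAxisDomination`). For a plaquette reflection
`ϑ` of the tree (link `WilsonRP.plaqReflect`, site `WilsonSiteRP.sitePlaqReflect`, odd-torus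
`WilsonRP.plaqReflect`) the reflection-positivity Cauchy–Schwarz inequality of part 5
(`…PlaqReflectCauchySchwarz`) for a pair of positive (or shared) plaquettes `p = (x[0↦a], q)`,
`p' = (y[0↦b], q')` is, after two translations of the torus Wilson state, the domination of the
covariance of ANY pair `((x,q),(y,q'))` with time separation `y₀ − x₀ = b − (ϑp)₀` by the product of the
two DIAGONAL time-axis covariances at separations `a − (ϑp)₀`, `b − (ϑp')₀` (`engine`, `placed_link`,
`placed_site`, `placed_odd`), plus the bookkeeping of reflected base times and of the positivity
predicates for plaquettes placed at a given time. Registered sub-goal of this file: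
`stub_covPairTranslate` (translation invariance of pair covariances, two planes). Parts B/C
(`…OffAxisCore`, `…OffAxisDomination`) do the case analysis and the transport to the crux's vocabulary.
-/

noncomputable section

open MeasureTheory
open Literature.MathematicalPhysics.QuantumFieldTheory

/-! ## Off-axis domination: engines (one per reflection) -/

namespace Summit.QuantumFields.YangMills.Theorems.FemtoCurvatureTwoPoint.AxisCovNonneg

section Engines

variable {d L N : ℕ} [NeZero d] [NeZero L] {G : Type*} [Group G] [TopologicalSpace G]
  [IsTopologicalGroup G] [CompactSpace G] [MeasurableSpace G] [BorelSpace G]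
  (ρ : G →* Matrix (Fin N) (Fin N) ℂ)

omit [NeZero d] in
/-- **Translation invariance of pair covariances, two planes.** [folklore] -/
theorem covPair_translate (β : ℝ) (a b v : Site d L) (q q' : {p : Fin d × Fin d // p.1 < p.2}) :
    (wilsonExpectation ρ β (fun U => WilsonRP.plaqRe ρ U (((a, q) : Plaquette d L)) * WilsonRP.plaqRe ρ U (((b, q') : Plaquette d L)))
        - wilsonExpectation ρ β (fun U => WilsonRP.plaqRe ρ U (((a, q) : Plaquette d L)))
        * wilsonExpectation ρ β (fun U => WilsonRP.plaqRe ρ U (((b, q') : Plaquette d L)))) =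
      (wilsonExpectation ρ β (fun U => WilsonRP.plaqRe ρ U (((a - v, q) : Plaquette d L)) * WilsonRP.plaqRe ρ U (((b - v, q') : Plaquette d L)))
          - wilsonExpectation ρ β (fun U => WilsonRP.plaqRe ρ U (((a - v, q) : Plaquette d L)))
          * wilsonExpectation ρ β (fun U => WilsonRP.plaqRe ρ U (((b - v, q') : Plaquette d L)))) := by
  have h1 := wilsonExpectation_comp_torusConfigShift ρ β v
    (fun U : GaugeConfig d L G => WilsonRP.plaqRe ρ U (a, q) * WilsonRP.plaqRe ρ U (b, q'))
  have h2 := wilsonExpectation_comp_torusConfigShift ρ β v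
    (fun U : GaugeConfig d L G => WilsonRP.plaqRe ρ U (a, q))
  have h3 := wilsonExpectation_comp_torusConfigShift ρ β v
    (fun U : GaugeConfig d L G => WilsonRP.plaqRe ρ U (b, q'))
  simp only [Function.comp_def, plaqRe_torusConfigShift] at h1 h2 h3
  rw [h1, h2, h3]

omit [NeZero d] in
/-- Symmetry of pair covariances, two planes. [folklore] -/
theorem covPair_symm (β : ℝ) (p p' : Plaquette d L) : (wilsonExpectation ρ β (fun U => WilsonRP.plaqRe ρ U p * WilsonRP.plaqRe ρ U p')
    - wilsonExpectation ρ β (fun U => WilsonRP.plaqRe ρ U p)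
    * wilsonExpectation ρ β (fun U => WilsonRP.plaqRe ρ U p')) = (wilsonExpectation ρ β (fun U => WilsonRP.plaqRe ρ U p' * WilsonRP.plaqRe ρ U p)
    - wilsonExpectation ρ β (fun U => WilsonRP.plaqRe ρ U p') * wilsonExpectation ρ β (fun U => WilsonRP.plaqRe ρ U p)) := by
  have h : (fun U : GaugeConfig d L G => WilsonRP.plaqRe ρ U p * WilsonRP.plaqRe ρ U p') =
      fun U => WilsonRP.plaqRe ρ U p' * WilsonRP.plaqRe ρ U p := by
    funext U; ring
  rw [h, mul_comm (wilsonExpectation ρ β fun U : GaugeConfig d L G => WilsonRP.plaqRe ρ U p)]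

omit [NeZero L] in
/-- The link reflection of plaquettes does not move the spatial coordinates of the base point.
[folklore] -/
theorem plaqReflect_fst_apply_of_ne (p : Plaquette d L) {k : Fin d} (hk : k ≠ 0) :
    (WilsonRP.plaqReflect p).1 k = p.1 k := by
  unfold WilsonRP.plaqReflect
  split_ifs
  · show (p.1.shift 0).timeReflect k = p.1 k
    rw [WilsonRP.timeReflect_apply_of_ne _ hk, WilsonRP.shift_apply_of_ne _ hk]
  · show p.1.timeReflect k = p.1 k
    rw [WilsonRP.timeReflect_apply_of_ne _ hk]

omit [NeZero L] in
/-- The site reflection of plaquettes does not move the spatial coordinates of the base point.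
[folklore] -/
theorem sitePlaqReflect_fst_apply_of_ne (p : Plaquette d L) {k : Fin d} (hk : k ≠ 0) :
    (WilsonSiteRP.sitePlaqReflect p).1 k = p.1 k := by
  unfold WilsonSiteRP.sitePlaqReflect
  split_ifs
  · show (p.1.shift 0).negReflect k = p.1 k
    rw [WilsonSiteRP.negReflect_apply_of_ne _ hk, WilsonRP.shift_apply_of_ne _ hk]
  · show p.1.negReflect k = p.1 k
    rw [WilsonSiteRP.negReflect_apply_of_ne _ hk]

/-- **Engine (generic).** For a plaquette map `ϑ` keeping the plane and the spatial coordinates of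
the base point (the two plaquette reflections of the tree), and the reflection-positivity
Cauchy–Schwarz inequality for the pair `(p, p')`, the covariance of ANY pair `((x, p.2), (y, p'.2))`
with the same spatial coordinates and time separation `y₀ − x₀ = p'₀ − (ϑp)₀` is dominated by the
product of the two DIAGONAL covariances at the time-axis separations `p₀ − (ϑp)₀` and `p'₀ − (ϑp')₀`
(translation invariance of the torus Wilson state). [folklore] -/
theorem engine (β : ℝ) (ϑ : Plaquette d L → Plaquette d L)
    (hϑ2 : ∀ p, (ϑ p).2 = p.2) (hϑsp : ∀ p (k : Fin d), k ≠ 0 → (ϑ p).1 k = p.1 k)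
    {p p' : Plaquette d L}
    (hcs : (wilsonExpectation ρ β (fun U => WilsonRP.plaqRe ρ U (ϑ p) * WilsonRP.plaqRe ρ U p') - wilsonExpectation ρ β (fun U => WilsonRP.plaqRe ρ U (ϑ p))
        * wilsonExpectation ρ β (fun U => WilsonRP.plaqRe ρ U p')) ^ 2 ≤ (wilsonExpectation ρ β (fun U => WilsonRP.plaqRe ρ U (ϑ p) * WilsonRP.plaqRe ρ U p)
        - wilsonExpectation ρ β (fun U => WilsonRP.plaqRe ρ U (ϑ p))
        * wilsonExpectation ρ β (fun U => WilsonRP.plaqRe ρ U p)) * (wilsonExpectation ρ β (fun U => WilsonRP.plaqRe ρ U (ϑ p') * WilsonRP.plaqRe ρ U p')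
        - wilsonExpectation ρ β (fun U => WilsonRP.plaqRe ρ U (ϑ p')) * wilsonExpectation ρ β (fun U => WilsonRP.plaqRe ρ U p')))
    (x y : Site d L) (hpx : ∀ k : Fin d, k ≠ 0 → p.1 k = x k) (hpy : ∀ k : Fin d, k ≠ 0 → p'.1 k = y k)
    (hcross : y 0 - x 0 = p'.1 0 - (ϑ p).1 0) :
    (wilsonExpectation ρ β (fun U => WilsonRP.plaqRe ρ U (((x, p.2) : Plaquette d L)) * WilsonRP.plaqRe ρ U (((y, p'.2) : Plaquette d L)))
        - wilsonExpectation ρ β (fun U => WilsonRP.plaqRe ρ U (((x, p.2) : Plaquette d L)))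
        * wilsonExpectation ρ β (fun U => WilsonRP.plaqRe ρ U (((y, p'.2) : Plaquette d L)))) ^ 2 ≤
      (wilsonExpectation ρ β (fun U => WilsonRP.plaqRe ρ U ((((0 : Site d L), p.2) : Plaquette d L)) * WilsonRP.plaqRe ρ U (((Pi.single (0 : Fin d) (p.1 0 - (ϑ p).1 0), p.2) : Plaquette d L)))
          - wilsonExpectation ρ β (fun U => WilsonRP.plaqRe ρ U ((((0 : Site d L), p.2) : Plaquette d L)))
          * wilsonExpectation ρ β (fun U => WilsonRP.plaqRe ρ U (((Pi.single (0 : Fin d) (p.1 0 - (ϑ p).1 0), p.2) : Plaquette d L)))) *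
      (wilsonExpectation ρ β (fun U => WilsonRP.plaqRe ρ U ((((0 : Site d L), p'.2) : Plaquette d L)) * WilsonRP.plaqRe ρ U (((Pi.single (0 : Fin d) (p'.1 0 - (ϑ p').1 0), p'.2) : Plaquette d L)))
          - wilsonExpectation ρ β (fun U => WilsonRP.plaqRe ρ U ((((0 : Site d L), p'.2) : Plaquette d L)))
          * wilsonExpectation ρ β (fun U => WilsonRP.plaqRe ρ U (((Pi.single (0 : Fin d) (p'.1 0 - (ϑ p').1 0), p'.2) : Plaquette d L)))) := by
  -- the cross term is the covariance of the given pair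
  have hv1 : (ϑ p).1 - ((ϑ p).1 - x) = x := sub_sub_cancel _ _
  have hv2 : p'.1 - ((ϑ p).1 - x) = y := by
    funext k
    by_cases hk : k = 0
    · subst hk
      simp only [Pi.sub_apply]
      linear_combination -hcross
    · simp only [Pi.sub_apply, hϑsp p k hk, hpx k hk, hpy k hk]
      ring
  have e1 : (wilsonExpectation ρ β (fun U => WilsonRP.plaqRe ρ U (ϑ p) * WilsonRP.plaqRe ρ U p') - wilsonExpectation ρ β (fun U => WilsonRP.plaqRe ρ U (ϑ p))
      * wilsonExpectation ρ β (fun U => WilsonRP.plaqRe ρ U p')) = (wilsonExpectation ρ β (fun U => WilsonRP.plaqRe ρ U (((x, p.2) : Plaquette d L)) * WilsonRP.plaqRe ρ U (((y, p'.2) : Plaquette d L)))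
      - wilsonExpectation ρ β (fun U => WilsonRP.plaqRe ρ U (((x, p.2) : Plaquette d L)))
      * wilsonExpectation ρ β (fun U => WilsonRP.plaqRe ρ U (((y, p'.2) : Plaquette d L)))) := by
    have step : (wilsonExpectation ρ β (fun U => WilsonRP.plaqRe ρ U ((((ϑ p).1, p.2) : Plaquette d L)) * WilsonRP.plaqRe ρ U (((p'.1, p'.2) : Plaquette d L)))
        - wilsonExpectation ρ β (fun U => WilsonRP.plaqRe ρ U ((((ϑ p).1, p.2) : Plaquette d L)))
        * wilsonExpectation ρ β (fun U => WilsonRP.plaqRe ρ U (((p'.1, p'.2) : Plaquette d L)))) =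
        (wilsonExpectation ρ β (fun U => WilsonRP.plaqRe ρ U (((x, p.2) : Plaquette d L)) * WilsonRP.plaqRe ρ U (((y, p'.2) : Plaquette d L)))
            - wilsonExpectation ρ β (fun U => WilsonRP.plaqRe ρ U (((x, p.2) : Plaquette d L)))
            * wilsonExpectation ρ β (fun U => WilsonRP.plaqRe ρ U (((y, p'.2) : Plaquette d L)))) := by
      rw [covPair_translate ρ β (ϑ p).1 p'.1 ((ϑ p).1 - x) p.2 p'.2, hv1, hv2]
    have hϑp : ϑ p = ((ϑ p).1, p.2) := Prod.ext rfl (hϑ2 p)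
    rw [hϑp]
    exact step
  -- the diagonal terms are time-axis covariances
  have e2 : ∀ r : Plaquette d L, (wilsonExpectation ρ β (fun U => WilsonRP.plaqRe ρ U (ϑ r) * WilsonRP.plaqRe ρ U r)
      - wilsonExpectation ρ β (fun U => WilsonRP.plaqRe ρ U (ϑ r)) * wilsonExpectation ρ β (fun U => WilsonRP.plaqRe ρ U r)) =
      (wilsonExpectation ρ β (fun U => WilsonRP.plaqRe ρ U ((((0 : Site d L), r.2) : Plaquette d L)) * WilsonRP.plaqRe ρ U (((Pi.single (0 : Fin d) (r.1 0 - (ϑ r).1 0), r.2) : Plaquette d L)))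
          - wilsonExpectation ρ β (fun U => WilsonRP.plaqRe ρ U ((((0 : Site d L), r.2) : Plaquette d L)))
          * wilsonExpectation ρ β (fun U => WilsonRP.plaqRe ρ U (((Pi.single (0 : Fin d) (r.1 0 - (ϑ r).1 0), r.2) : Plaquette d L)))) := fun r => by
    have hdiff : r.1 - (ϑ r).1 = Pi.single (0 : Fin d) (r.1 0 - (ϑ r).1 0) := by
      funext k
      by_cases hk : k = 0
      · subst hk; simp
      · simp [hk, hϑsp r k hk]
    have step : (wilsonExpectation ρ β (fun U => WilsonRP.plaqRe ρ U ((((ϑ r).1, r.2) : Plaquette d L)) * WilsonRP.plaqRe ρ U (((r.1, r.2) : Plaquette d L)))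
        - wilsonExpectation ρ β (fun U => WilsonRP.plaqRe ρ U ((((ϑ r).1, r.2) : Plaquette d L)))
        * wilsonExpectation ρ β (fun U => WilsonRP.plaqRe ρ U (((r.1, r.2) : Plaquette d L)))) =
        (wilsonExpectation ρ β (fun U => WilsonRP.plaqRe ρ U ((((0 : Site d L), r.2) : Plaquette d L)) * WilsonRP.plaqRe ρ U (((Pi.single (0 : Fin d) (r.1 0 - (ϑ r).1 0), r.2) : Plaquette d L)))
            - wilsonExpectation ρ β (fun U => WilsonRP.plaqRe ρ U ((((0 : Site d L), r.2) : Plaquette d L)))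
            * wilsonExpectation ρ β (fun U => WilsonRP.plaqRe ρ U (((Pi.single (0 : Fin d) (r.1 0 - (ϑ r).1 0), r.2) : Plaquette d L)))) := by
      rw [covPair_translate ρ β (ϑ r).1 r.1 (ϑ r).1 r.2 r.2, sub_self, hdiff]
    have hϑr : ϑ r = ((ϑ r).1, r.2) := Prod.ext rfl (hϑ2 r)
    rw [hϑr]
    exact step
  rw [e1, e2 p, e2 p'] at hcs
  exact hcs

/-! ### Bookkeeping for plaquettes placed on the time axis -/

omit [NeZero L] in
/-- Time of the link-reflected base point: spatial plaquettes. [folklore] -/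
theorem plaqReflect_fst_zero_spatial (p : Plaquette d L) (hq : p.2.1.1 ≠ 0) :
    (WilsonRP.plaqReflect p).1 0 = 1 - p.1 0 := by
  simp [WilsonRP.plaqReflect, hq]

omit [NeZero L] in
/-- Time of the link-reflected base point: temporal plaquettes. [folklore] -/
theorem plaqReflect_fst_zero_temporal (p : Plaquette d L) (hq : p.2.1.1 = 0) :
    (WilsonRP.plaqReflect p).1 0 = -(p.1 0) := by
  simp [WilsonRP.plaqReflect, hq, WilsonRP.shift_apply_self]

omit [NeZero L] in
/-- Time of the site-reflected base point: spatial plaquettes. [folklore] -/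
theorem sitePlaqReflect_fst_zero_spatial (p : Plaquette d L) (hq : p.2.1.1 ≠ 0) :
    (WilsonSiteRP.sitePlaqReflect p).1 0 = -(p.1 0) := by
  simp [WilsonSiteRP.sitePlaqReflect, hq]

omit [NeZero L] in
/-- Time of the site-reflected base point: temporal plaquettes. [folklore] -/
theorem sitePlaqReflect_fst_zero_temporal (p : Plaquette d L) (hq : p.2.1.1 = 0) :
    (WilsonSiteRP.sitePlaqReflect p).1 0 = -(p.1 0) - 1 := by
  simp [WilsonSiteRP.sitePlaqReflect, hq, WilsonRP.shift_apply_self]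
  ring

omit [NeZero L] in
/-- Time coordinate of a base point placed at time `a < L`. [folklore] -/
theorem val_update_zero (x : Site d L) {a : ℕ} (ha : a < L) :
    ((Function.update x 0 ((a : ℕ) : ZMod L)) 0).val = a := by
  rw [Function.update_self, ZMod.val_natCast, Nat.mod_eq_of_lt ha]

omit [NeZero L] in
/-- Positivity of a plaquette placed at time `a` (link reflection). [folklore] -/
theorem isPosPlaq_placed (x : Site d L) {a : ℕ} (haL : a < L) (q : {p : Fin d × Fin d // p.1 < p.2}) :
    WilsonRP.IsPosPlaq (((Function.update x 0 ((a : ℕ) : ZMod L)), q) : Plaquette d L) ↔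
      1 ≤ a ∧ (if q.1.1 = 0 then a + 1 ≤ L / 2 else a ≤ L / 2) := by
  haveI : NeZero L := ⟨by omega⟩
  simp only [WilsonRP.IsPosPlaq, val_update_zero x haL]

omit [NeZero L] in
/-- Site-positivity of a plaquette placed at time `a`. [folklore] -/
theorem isSitePosPlaq_placed (x : Site d L) {a : ℕ} (haL : a < L)
    (q : {p : Fin d × Fin d // p.1 < p.2}) :
    WilsonSiteRP.IsSitePosPlaq (((Function.update x 0 ((a : ℕ) : ZMod L)), q) : Plaquette d L) ↔
      (if q.1.1 = 0 then a < L / 2 else 1 ≤ a ∧ a < L / 2) := by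
  haveI : NeZero L := ⟨by omega⟩
  simp only [WilsonSiteRP.IsSitePosPlaq, val_update_zero x haL]

omit [NeZero L] in
/-- Shared plaquettes placed at time `a` (site reflection). [folklore] -/
theorem isSharedPlaq_placed (x : Site d L) {a : ℕ} (haL : a < L)
    (q : {p : Fin d × Fin d // p.1 < p.2}) :
    WilsonSiteRP.IsSharedPlaq (((Function.update x 0 ((a : ℕ) : ZMod L)), q) : Plaquette d L) ↔
      q.1.1 ≠ 0 ∧ (a = 0 ∨ a = L / 2) := by
  haveI : NeZero L := ⟨by omega⟩
  simp only [WilsonSiteRP.IsSharedPlaq, val_update_zero x haL]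

omit [NeZero L] in
/-- Odd-positivity of a plaquette placed at time `a`. [folklore] -/
theorem isOPosPlaq_placed (x : Site d L) {a : ℕ} (haL : a < L) (q : {p : Fin d × Fin d // p.1 < p.2}) :
    WilsonOddRP.IsOPosPlaq (((Function.update x 0 ((a : ℕ) : ZMod L)), q) : Plaquette d L) ↔
      1 ≤ a ∧ a ≤ L / 2 := by
  haveI : NeZero L := ⟨by omega⟩
  simp only [WilsonOddRP.IsOPosPlaq, val_update_zero x haL]

omit [NeZero L] in
/-- Odd-shared plaquettes placed at time `a`. [folklore] -/
theorem isOSharedPlaq_placed (x : Site d L) {a : ℕ} (haL : a < L)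
    (q : {p : Fin d × Fin d // p.1 < p.2}) :
    WilsonOddRP.IsOSharedPlaq (((Function.update x 0 ((a : ℕ) : ZMod L)), q) : Plaquette d L) ↔
      q.1.1 ≠ 0 ∧ a = L / 2 + 1 := by
  haveI : NeZero L := ⟨by omega⟩
  simp only [WilsonOddRP.IsOSharedPlaq, val_update_zero x haL]

/-- **Placed link engine** (`L` even, `β ≥ 0`): plaquettes `p = (x[0↦a], q)`, `p' = (y[0↦b], q')`,
both link-positive. [folklore] -/
theorem placed_link (hL : Even L) (hρ : Continuous ρ) {β : ℝ} (hβ : 0 ≤ β)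
    (q q' : {p : Fin d × Fin d // p.1 < p.2}) (x y : Site d L) (a b : ℕ)
    (hp : WilsonRP.IsPosPlaq (((Function.update x 0 ((a : ℕ) : ZMod L)), q) : Plaquette d L))
    (hp' : WilsonRP.IsPosPlaq (((Function.update y 0 ((b : ℕ) : ZMod L)), q') : Plaquette d L))
    (hcross : y 0 - x 0 = ((b : ℕ) : ZMod L) -
      (WilsonRP.plaqReflect (((Function.update x 0 ((a : ℕ) : ZMod L)), q) : Plaquette d L)).1 0) :
    (wilsonExpectation ρ β (fun U => WilsonRP.plaqRe ρ U (((x, q) : Plaquette d L)) * WilsonRP.plaqRe ρ U (((y, q') : Plaquette d L)))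
        - wilsonExpectation ρ β (fun U => WilsonRP.plaqRe ρ U (((x, q) : Plaquette d L)))
        * wilsonExpectation ρ β (fun U => WilsonRP.plaqRe ρ U (((y, q') : Plaquette d L)))) ^ 2 ≤
      (wilsonExpectation ρ β (fun U => WilsonRP.plaqRe ρ U ((((0 : Site d L), q) : Plaquette d L)) * WilsonRP.plaqRe ρ U (((Pi.single (0 : Fin d) (((a : ℕ) : ZMod L) - (WilsonRP.plaqReflect (((Function.update x 0 ((a : ℕ) : ZMod L)), q) : Plaquette d L)).1 0), q) : Plaquette d L)))
          - wilsonExpectation ρ β (fun U => WilsonRP.plaqRe ρ U ((((0 : Site d L), q) : Plaquette d L)))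
          * wilsonExpectation ρ β (fun U => WilsonRP.plaqRe ρ U (((Pi.single (0 : Fin d) (((a : ℕ) : ZMod L) - (WilsonRP.plaqReflect (((Function.update x 0 ((a : ℕ) : ZMod L)), q) : Plaquette d L)).1 0), q) : Plaquette d L)))) *
      (wilsonExpectation ρ β (fun U => WilsonRP.plaqRe ρ U ((((0 : Site d L), q') : Plaquette d L)) * WilsonRP.plaqRe ρ U (((Pi.single (0 : Fin d) (((b : ℕ) : ZMod L) - (WilsonRP.plaqReflect (((Function.update y 0 ((b : ℕ) : ZMod L)), q') : Plaquette d L)).1 0), q') : Plaquette d L)))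
          - wilsonExpectation ρ β (fun U => WilsonRP.plaqRe ρ U ((((0 : Site d L), q') : Plaquette d L)))
          * wilsonExpectation ρ β (fun U => WilsonRP.plaqRe ρ U (((Pi.single (0 : Fin d) (((b : ℕ) : ZMod L) - (WilsonRP.plaqReflect (((Function.update y 0 ((b : ℕ) : ZMod L)), q') : Plaquette d L)).1 0), q') : Plaquette d L)))) := by
  have h := engine ρ β WilsonRP.plaqReflect (fun _ => rfl) (fun p k hk => plaqReflect_fst_apply_of_ne p hk)
    (cov_plaqReflect_sq_le_even ρ hL hρ hβ hp hp') x y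
    (fun k hk => by simp [hk]) (fun k hk => by simp [hk]) (by simpa using hcross)
  simpa using h

/-- **Placed site engine** (`L` even, any `β ≥ 0` not needed but kept uniform): plaquettes
`p = (x[0↦a], q)`, `p' = (y[0↦b], q')`, site-positive or shared. [folklore] -/
theorem placed_site (hL : Even L) (hρ : Continuous ρ) (β : ℝ)
    (q q' : {p : Fin d × Fin d // p.1 < p.2}) (x y : Site d L) (a b : ℕ)
    (hp : WilsonSiteRP.IsSitePosPlaq (((Function.update x 0 ((a : ℕ) : ZMod L)), q) : Plaquette d L) ∨
      WilsonSiteRP.IsSharedPlaq (((Function.update x 0 ((a : ℕ) : ZMod L)), q) : Plaquette d L))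
    (hp' : WilsonSiteRP.IsSitePosPlaq (((Function.update y 0 ((b : ℕ) : ZMod L)), q') : Plaquette d L) ∨
      WilsonSiteRP.IsSharedPlaq (((Function.update y 0 ((b : ℕ) : ZMod L)), q') : Plaquette d L))
    (hcross : y 0 - x 0 = ((b : ℕ) : ZMod L) -
      (WilsonSiteRP.sitePlaqReflect (((Function.update x 0 ((a : ℕ) : ZMod L)), q) : Plaquette d L)).1 0) :
    (wilsonExpectation ρ β (fun U => WilsonRP.plaqRe ρ U (((x, q) : Plaquette d L)) * WilsonRP.plaqRe ρ U (((y, q') : Plaquette d L)))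
        - wilsonExpectation ρ β (fun U => WilsonRP.plaqRe ρ U (((x, q) : Plaquette d L)))
        * wilsonExpectation ρ β (fun U => WilsonRP.plaqRe ρ U (((y, q') : Plaquette d L)))) ^ 2 ≤
      (wilsonExpectation ρ β (fun U => WilsonRP.plaqRe ρ U ((((0 : Site d L), q) : Plaquette d L)) * WilsonRP.plaqRe ρ U (((Pi.single (0 : Fin d) (((a : ℕ) : ZMod L) - (WilsonSiteRP.sitePlaqReflect (((Function.update x 0 ((a : ℕ) : ZMod L)), q) : Plaquette d L)).1 0), q) : Plaquette d L)))
          - wilsonExpectation ρ β (fun U => WilsonRP.plaqRe ρ U ((((0 : Site d L), q) : Plaquette d L)))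
          * wilsonExpectation ρ β (fun U => WilsonRP.plaqRe ρ U (((Pi.single (0 : Fin d) (((a : ℕ) : ZMod L) - (WilsonSiteRP.sitePlaqReflect (((Function.update x 0 ((a : ℕ) : ZMod L)), q) : Plaquette d L)).1 0), q) : Plaquette d L)))) *
      (wilsonExpectation ρ β (fun U => WilsonRP.plaqRe ρ U ((((0 : Site d L), q') : Plaquette d L)) * WilsonRP.plaqRe ρ U (((Pi.single (0 : Fin d) (((b : ℕ) : ZMod L) - (WilsonSiteRP.sitePlaqReflect (((Function.update y 0 ((b : ℕ) : ZMod L)), q') : Plaquette d L)).1 0), q') : Plaquette d L)))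
          - wilsonExpectation ρ β (fun U => WilsonRP.plaqRe ρ U ((((0 : Site d L), q') : Plaquette d L)))
          * wilsonExpectation ρ β (fun U => WilsonRP.plaqRe ρ U (((Pi.single (0 : Fin d) (((b : ℕ) : ZMod L) - (WilsonSiteRP.sitePlaqReflect (((Function.update y 0 ((b : ℕ) : ZMod L)), q') : Plaquette d L)).1 0), q') : Plaquette d L)))) := by
  have h := engine ρ β WilsonSiteRP.sitePlaqReflect (fun _ => rfl)
    (fun p k hk => sitePlaqReflect_fst_apply_of_ne p hk)
    (cov_sitePlaqReflect_sq_le ρ hL hρ β hp hp') x y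
    (fun k hk => by simp [hk]) (fun k hk => by simp [hk]) (by simpa using hcross)
  simpa using h

/-- **Placed odd engine** (`L` odd, `L ≥ 3`, `β ≥ 0`): plaquettes `p = (x[0↦a], q)`,
`p' = (y[0↦b], q')`, odd-positive or odd-shared. [folklore] -/
theorem placed_odd (hL : Odd L) (hL3 : 3 ≤ L) (hρ : Continuous ρ) {β : ℝ} (hβ : 0 ≤ β)
    (q q' : {p : Fin d × Fin d // p.1 < p.2}) (x y : Site d L) (a b : ℕ)
    (hp : WilsonOddRP.IsOPosPlaq (((Function.update x 0 ((a : ℕ) : ZMod L)), q) : Plaquette d L) ∨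
      WilsonOddRP.IsOSharedPlaq (((Function.update x 0 ((a : ℕ) : ZMod L)), q) : Plaquette d L))
    (hp' : WilsonOddRP.IsOPosPlaq (((Function.update y 0 ((b : ℕ) : ZMod L)), q') : Plaquette d L) ∨
      WilsonOddRP.IsOSharedPlaq (((Function.update y 0 ((b : ℕ) : ZMod L)), q') : Plaquette d L))
    (hcross : y 0 - x 0 = ((b : ℕ) : ZMod L) -
      (WilsonRP.plaqReflect (((Function.update x 0 ((a : ℕ) : ZMod L)), q) : Plaquette d L)).1 0) :
    (wilsonExpectation ρ β (fun U => WilsonRP.plaqRe ρ U (((x, q) : Plaquette d L)) * WilsonRP.plaqRe ρ U (((y, q') : Plaquette d L)))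
        - wilsonExpectation ρ β (fun U => WilsonRP.plaqRe ρ U (((x, q) : Plaquette d L)))
        * wilsonExpectation ρ β (fun U => WilsonRP.plaqRe ρ U (((y, q') : Plaquette d L)))) ^ 2 ≤
      (wilsonExpectation ρ β (fun U => WilsonRP.plaqRe ρ U ((((0 : Site d L), q) : Plaquette d L)) * WilsonRP.plaqRe ρ U (((Pi.single (0 : Fin d) (((a : ℕ) : ZMod L) - (WilsonRP.plaqReflect (((Function.update x 0 ((a : ℕ) : ZMod L)), q) : Plaquette d L)).1 0), q) : Plaquette d L)))
          - wilsonExpectation ρ β (fun U => WilsonRP.plaqRe ρ U ((((0 : Site d L), q) : Plaquette d L)))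
          * wilsonExpectation ρ β (fun U => WilsonRP.plaqRe ρ U (((Pi.single (0 : Fin d) (((a : ℕ) : ZMod L) - (WilsonRP.plaqReflect (((Function.update x 0 ((a : ℕ) : ZMod L)), q) : Plaquette d L)).1 0), q) : Plaquette d L)))) *
      (wilsonExpectation ρ β (fun U => WilsonRP.plaqRe ρ U ((((0 : Site d L), q') : Plaquette d L)) * WilsonRP.plaqRe ρ U (((Pi.single (0 : Fin d) (((b : ℕ) : ZMod L) - (WilsonRP.plaqReflect (((Function.update y 0 ((b : ℕ) : ZMod L)), q') : Plaquette d L)).1 0), q') : Plaquette d L)))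
          - wilsonExpectation ρ β (fun U => WilsonRP.plaqRe ρ U ((((0 : Site d L), q') : Plaquette d L)))
          * wilsonExpectation ρ β (fun U => WilsonRP.plaqRe ρ U (((Pi.single (0 : Fin d) (((b : ℕ) : ZMod L) - (WilsonRP.plaqReflect (((Function.update y 0 ((b : ℕ) : ZMod L)), q') : Plaquette d L)).1 0), q') : Plaquette d L)))) := by
  have h := engine ρ β WilsonRP.plaqReflect (fun _ => rfl) (fun p k hk => plaqReflect_fst_apply_of_ne p hk)
    (cov_plaqReflect_sq_le_odd ρ hL hL3 hρ hβ hp hp') x y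
    (fun k hk => by simp [hk]) (fun k hk => by simp [hk]) (by simpa using hcross)
  simpa using h
end Engines

end Summit.QuantumFields.YangMills.Theorems.FemtoCurvatureTwoPoint.AxisCovNonneg

namespace Summit.QuantumFields.YangMills.Theorems.FemtoCurvatureTwoPoint

/-- **Registered sub-goal `stub_covPairTranslate`** (`--supports stmt-QuantumFields-9363`): translation
invariance of pair covariances of plaquette functions in two planes (closed form of
`AxisCovNonneg.covPair_translate`, fully qualified). [folklore] -/
theorem stub_covPairTranslate : ∀ (d L N : ℕ) [NeZero d] [NeZero L] (G : Type) [Group G] [TopologicalSpace G] [IsTopologicalGroup G] [CompactSpace G] [MeasurableSpace G] [BorelSpace G] (ρ : G →* Matrix (Fin N) (Fin N) ℂ) (β : ℝ) (a b v : Literature.MathematicalPhysics.QuantumFieldTheory.Site d L) (q q' : {p : Fin d × Fin d // p.1 < p.2}), (Literature.MathematicalPhysics.QuantumFieldTheory.wilsonExpectation ρ β (fun U : Literature.MathematicalPhysics.QuantumFieldTheory.GaugeConfig d L G => Literature.MathematicalPhysics.QuantumFieldTheory.WilsonRP.plaqRe ρ U (((a, q)) : Literature.MathematicalPhysics.QuantumFieldTheory.Plaquette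 d L) * Literature.MathematicalPhysics.QuantumFieldTheory.WilsonRP.plaqRe ρ U (((b, q')) : Literature.MathematicalPhysics.QuantumFieldTheory.Plaquette d L)) - Literature.MathematicalPhysics.QuantumFieldTheory.wilsonExpectation ρ β (fun U : Literature.MathematicalPhysics.QuantumFieldTheory.GaugeConfig d L G => Literature.MathematicalPhysics.QuantumFieldTheory.WilsonRP.plaqRe ρ U (((a, q)) : Literature.MathematicalPhysics.QuantumFieldTheory.Plaquette d L)) * Literature.MathematicalPhysics.QuantumFieldTheory.wilsonExpectation ρ β (fun U : Literature.MathematicalPhysics.QuantumFieldTheory.GaugeConfig d L G => Literature.MathematicalPhysics.QuantumFieldTheory.WilsonRP.plaqRe ρ U (((b, q')) : Literature.MathematicalPhysics.QuantumFieldTheory.Plaquette d L))) = (Literature.MathematicalPhysics.QuantumFieldTheory.wilsonExpectation ρ β (fun U : Literature.MathematicalPhysics.QuantumFieldTheory.GaugeConfig d L G => Literature.MathematicalPhysics.QuantumFieldTheory.WilsonRP.plaqRe ρ U (((a - v, q)) : Literature.MathematicalPhysics.QuantumFieldTheory.Plaquette d L) * Literature.MathematicalPhysics.QuantumFieldTheory.WilsonRP.plaqRe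 ρ U (((b - v, q')) : Literature.MathematicalPhysics.QuantumFieldTheory.Plaquette d L)) - Literature.MathematicalPhysics.QuantumFieldTheory.wilsonExpectation ρ β (fun U : Literature.MathematicalPhysics.QuantumFieldTheory.GaugeConfig d L G => Literature.MathematicalPhysics.QuantumFieldTheory.WilsonRP.plaqRe ρ U (((a - v, q)) : Literature.MathematicalPhysics.QuantumFieldTheory.Plaquette d L)) * Literature.MathematicalPhysics.QuantumFieldTheory.wilsonExpectation ρ β (fun U : Literature.MathematicalPhysics.QuantumFieldTheory.GaugeConfig d L G => Literature.MathematicalPhysics.QuantumFieldTheory.WilsonRP.plaqRe ρ U (((b - v, q')) : Literature.MathematicalPhysics.QuantumFieldTheory.Plaquette d L))) := by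
  intro d L N _ _ G _ _ _ _ _ _ ρ β a b v q q'
  exact AxisCovNonneg.covPair_translate ρ β a b v q q'

end Summit.QuantumFields.YangMills.Theorems.FemtoCurvatureTwoPoint

end
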